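import Literature.Probability.RandomPlanarGeometry.HexSAWBrickWallSlabFugacity
import Literature.Probability.RandomPlanarGeometry.HexSAWBrickWallSlabInsertion
import HarnessLib

/-!
# The double-row slab insertion and the boundary-column fugacity: `i(ω) ≤ i(Ψ(ω,R)) ≤ i(ω) + 2·|R|`, and the weighted core

Topic `Literature/Probability/RandomPlanarGeometry` (continues `HexSAWBrickWallSlabFugacity.lean` — the partition
functions `HexBW.slabZ H n y = Ĉ_{H,n}(y,1)` of the armchair slabs `Slab_H = {0 ≤ x₀ ≤ H}` with a fugacity `y` per vertex
in the column `x₀ = 0`, growth rates `HexBW.slabMuY H y` — and `HexSAWBrickWallSlabInsertion.lean` — the double-row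
insertion `HexBW.slabInsertion` of the door «HEX-ARMCHAIR-SLAB-SUBCRIT» (R100): (walk of `Slab_H`, admissible cut set
`R`) ↦ walk of `Slab_{H+1}` of length `n + Σ cost`, injective).  Source of the statement served: N. R. Beaton,
*J. Phys. A* 47 (2014) 075003, arXiv:1210.0274v3, §3.2, Proposition 9 (p. 15): "For `y > 0`, `μ_T(1,y) < μ_{T+1}(1,y)`"
("The proof is virtually identical to that of Proposition 7 in [BBdGDCG]" — qualitative); the lane proves it (next file)
by the insertion, whose effect on the surface weight is controlled HERE: every inserted cell of a cut lies in one of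
the two fresh rows and in a column `≥` the column of its strand (`SlabInsertion.mem_block`), strands of one cut have
distinct columns (`crossTimes_col_inj`), so at most one strand per cut sits in the column `0` and it adds at most two
column-`0` cells.  This file is the armchair twin of `HexSAWBrickWallStripFugacityInsertion.lean`.

## What is proved (namespace `Literature.Probability.RandomPlanarGeometry.SAW.HexBW`)

* `SlabInsertion.countP_colZero_imageList` — `i(ω) ≤ i(Ψ(ω,R)) ≤ i(ω) + 2·|R|` for the image list;
* `leftVisits_slabInsertion` — the same for the pair `HexBW.slabInsertion H n p R`;
* **`slab_weighted_core`** — for `0 < x ≤ 1`, `y > 0`, `θ = min 1 (y²)`: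
  `Ĉ_{H,n}(y) xⁿ (1 + θ x^{2H+4})^{⌊n/(2(H+1))⌋} ≤ Σ_{m ≤ (2H+5)n} Ĉ_{H+1,m}(y) x^m`.
-/

noncomputable section

open Finset Filter Topology Literature.Probability.LatticeModels Literature.Probability.Percolation SimpleGraph

namespace Literature.Probability.RandomPlanarGeometry.SAW.HexBW

namespace SlabInsertion

open StripInsertion (eq_mk)

variable {H n : ℕ} {ω : ℕ → Site 2} {y₀ : ℤ} {R : Finset ℤ}

/-! ### Row-zero cells of a block -/

/-- The test "the cell lies in the bottom row". [cite: BeatonBousquetMelouDeGierDuminilCopinGuttmann2014, §3.2 (arXiv v5 p. 11: vertices in the bottom line)] -/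
def colZero (z : Site 2) : Bool := decide (z 0 = 0)

/-- Every block is its anchor followed by a rest. [cite: MadrasSlade1993, §8.2, Theorem 8.2.1 (8.2.13), p. 269 (statement; the insertion is the lane's proof)] -/
theorem block_eq_cons (H : ℕ) (y₀ : ℤ) (R : Finset ℤ) (ω : ℕ → Site 2) (n t : ℕ) :
    ∃ rest, block H y₀ R ω n t = vmap y₀ R (ω t) :: rest := by
  unfold block; split_ifs <;> exact ⟨_, rfl⟩

/-- A duplicate-free list of planar sites all in the column `0` and in two given rows has length `≤ 2`.
[cite: MadrasSlade1993, §8.2, Theorem 8.2.1 (8.2.13), p. 269] -/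
theorem length_le_two_of_colZero {l : List (Site 2)} (hN : l.Nodup) {a : ℤ}
    (hrow : ∀ z ∈ l, a + 1 ≤ z 1 ∧ z 1 ≤ a + 2) (hcol : ∀ z ∈ l, z 0 = 0) : l.length ≤ 2 := by
  classical
  have hinj : Set.InjOn (fun z : Site 2 => z 1) {z | z ∈ l} := by
    intro z hz z' hz' h
    have h' : z 1 = z' 1 := h
    rw [eq_mk z, eq_mk z', h', hcol z hz, hcol z' hz']
  have hN' : (l.map fun z : Site 2 => z 1).Nodup := hN.map_on fun z hz z' hz' h => hinj hz hz' h
  have hsub : (l.map fun z : Site 2 => z 1).toFinset ⊆ Finset.Icc (a + 1) (a + 2) := by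
    intro v hv
    rw [List.mem_toFinset, List.mem_map] at hv
    obtain ⟨z, hz, rfl⟩ := hv
    exact Finset.mem_Icc.2 (hrow z hz)
  have h := Finset.card_le_card hsub
  rw [List.toFinset_card_of_nodup hN', List.length_map, Int.card_Icc] at h
  have e : (a + 2 + 1 - (a + 1)).toNat = 2 := by omega
  omega

/-- **The column-`0` cells of a block**: the anchor contributes `[ω t ∈ column 0]`; the inserted cells contribute at
most `2`, and nothing unless the step is a crossing of a cut of `R` whose strand lies in the column `0`.
[cite: MadrasSlade1993, §8.2, Theorem 8.2.1 (8.2.13), p. 269 (statement; the insertion is the lane's proof)] -/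
theorem countP_colZero_block (hW : SlabWalk H ω n) {t : ℕ} (ht : t < n) :
    ∃ k : ℕ, (block H y₀ R ω n t).countP colZero = (if ω t 0 = 0 then 1 else 0) + k ∧ k ≤ 2 ∧
      (k ≠ 0 → (ω t 1 ≠ ω (t + 1) 1 ∧ cutOf ω t ∈ R) ∧ ω t 0 = 0) := by
  classical
  obtain ⟨rest, hrest⟩ := block_eq_cons H y₀ R ω n t
  have hnd := nodup_block (H := H) y₀ R ω n t
  rw [hrest, List.nodup_cons] at hnd
  -- every cell of `rest` is an inserted cell of the cut `cutOf ω t ∈ R`, in a column `≥ ω t 0`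
  have hrest_mem : ∀ z ∈ rest, (ω t 1 ≠ ω (t + 1) 1 ∧ cutOf ω t ∈ R ∧
      (rowMap y₀ R (cutOf ω t) + 1 ≤ z 1 ∧ z 1 ≤ rowMap y₀ R (cutOf ω t) + 2) ∧ ω t 0 ≤ z 0) := by
    intro z hz
    have hz' : z ∈ block H y₀ R ω n t := by rw [hrest]; exact List.mem_cons_of_mem _ hz
    rcases mem_block hz' with h | ⟨hne, hRc, hrow, hc1, -⟩
    · exact absurd (h ▸ hz) hnd.1
    · exact ⟨hne, hRc, hrow, hc1⟩
  refine ⟨rest.countP colZero, ?_, ?_, ?_⟩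
  · rw [hrest, List.countP_cons]
    simp only [colZero, vmap_zero, decide_eq_true_eq]
    split_ifs <;> omega
  · rw [List.countP_eq_length_filter]
    refine length_le_two_of_colZero (hnd.2.filter _) (a := rowMap y₀ R (cutOf ω t))
      (fun z hz => (hrest_mem z (List.mem_of_mem_filter hz)).2.2.1) fun z hz => ?_
    have := (List.mem_filter.1 hz).2
    simpa [colZero] using this
  · intro hk
    obtain ⟨z, hz, hz0⟩ := List.countP_pos_iff.1 (Nat.pos_of_ne_zero hk)
    obtain ⟨hne, hRc, -, hc1⟩ := hrest_mem z hz
    have hz1 : z 0 = 0 := by simpa [colZero] using hz0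
    have h0 := hW.col_nonneg t ht.le
    exact ⟨⟨hne, hRc⟩, by omega⟩

/-! ### Column-zero cells of the image list -/

/-- The column-`0` vertex count of `ω` on `[0, n]` as a sum of indicators. [cite: BeatonBousquetMelouDeGierDuminilCopinGuttmann2014, §3.2 (arXiv v5 p. 11)] -/
def visitsC0 (ω : ℕ → Site 2) (n : ℕ) : ℕ := ∑ t ∈ Finset.range (n + 1), if ω t 0 = 0 then 1 else 0

/-- A sum over a finite set of terms `≤ 2` of which at most one is nonzero is `≤ 2`. [folklore] -/
private theorem sum_le_two_of_unique {s : Finset ℕ} {f : ℕ → ℕ} (hle : ∀ t ∈ s, f t ≤ 2)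
    (huniq : ∀ t ∈ s, ∀ t' ∈ s, f t ≠ 0 → f t' ≠ 0 → t = t') : ∑ t ∈ s, f t ≤ 2 := by
  classical
  by_cases h : ∃ t ∈ s, f t ≠ 0
  · obtain ⟨t₀, ht₀, hf⟩ := h
    rw [← Finset.add_sum_erase _ _ ht₀]
    have : ∑ t ∈ s.erase t₀, f t = 0 :=
      Finset.sum_eq_zero fun t ht => by
        by_contra hne
        exact (Finset.ne_of_mem_erase ht) (huniq t (Finset.mem_of_mem_erase ht) t₀ ht₀ hne hf)
    rw [this, add_zero]; exact hle t₀ ht₀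
  · push Not at h
    rw [Finset.sum_eq_zero h]; omega

/-- **`i(ω) ≤ i(Ψ(ω,R)) ≤ i(ω) + 2·|R|`** at the level of the image list: the number of column-`0` cells of the image is
the number of column-`0` vertices of `ω` plus, for each cut of `R`, at most two inserted cells (those of the unique
strand of the cut in the column `0`, if any). [cite: MadrasSlade1993, §8.2, Theorem 8.2.1 (8.2.13), p. 269 (statement; the insertion is the lane's proof)] -/
theorem countP_colZero_imageList (hW : SlabWalk H ω n) :
    visitsC0 ω n ≤ (imageList H y₀ R ω n).countP colZero ∧
      (imageList H y₀ R ω n).countP colZero ≤ visitsC0 ω n + 2 * R.card := by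
  classical
  choose k hk using fun t : {t // t < n} => countP_colZero_block (y₀ := y₀) (R := R) hW t.2
  set K : ℕ → ℕ := fun t => if h : t < n then k ⟨t, h⟩ else 0 with hKdef
  have hK : ∀ t, t < n → (block H y₀ R ω n t).countP colZero = (if ω t 0 = 0 then 1 else 0) + K t ∧ K t ≤ 2 ∧
      (K t ≠ 0 → (ω t 1 ≠ ω (t + 1) 1 ∧ cutOf ω t ∈ R) ∧ ω t 0 = 0) := by
    intro t ht
    have := hk ⟨t, ht⟩
    simp only [hKdef, dif_pos ht]
    exact this
  have htot : (imageList H y₀ R ω n).countP colZero =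
      visitsC0 ω n + ∑ t ∈ Finset.range n, K t := by
    rw [imageList, List.countP_append, List.countP_flatMap, StripInsertion.list_sum_map_range]
    have e1 : ∑ t ∈ Finset.range n, (block H y₀ R ω n t).countP colZero =
        ∑ t ∈ Finset.range n, ((if ω t 0 = 0 then 1 else 0) + K t) :=
      Finset.sum_congr rfl fun t ht => (hK t (Finset.mem_range.1 ht)).1
    have e2 : [vmap y₀ R (ω n)].countP colZero = if ω n 0 = 0 then 1 else 0 := by
      simp [colZero]
    rw [Function.comp_def, e1, e2, Finset.sum_add_distrib, visitsC0, Finset.sum_range_succ]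
    ring
  refine ⟨by rw [htot]; omega, ?_⟩
  rw [htot, add_le_add_iff_left]
  have hzero : ∀ t ∈ Finset.range n, ¬ (ω t 1 ≠ ω (t + 1) 1 ∧ cutOf ω t ∈ R) → K t = 0 := by
    intro t ht h
    by_contra hne
    exact h ((hK t (Finset.mem_range.1 ht)).2.2 hne).1
  rw [← Finset.sum_filter_of_ne (p := fun t => ω t 1 ≠ ω (t + 1) 1 ∧ cutOf ω t ∈ R)
    (fun t ht hne => by by_contra h; exact hne (hzero t ht h))]
  have hmaps : ∀ t ∈ (Finset.range n).filter (fun t => ω t 1 ≠ ω (t + 1) 1 ∧ cutOf ω t ∈ R),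
      cutOf ω t ∈ R := fun t ht => (Finset.mem_filter.1 ht).2.2
  rw [← Finset.sum_fiberwise_of_maps_to hmaps]
  have hinner : ∀ c ∈ R,
      ∑ t ∈ ((Finset.range n).filter (fun t => ω t 1 ≠ ω (t + 1) 1 ∧ cutOf ω t ∈ R)).filter
          (fun t => cutOf ω t = c), K t ≤ 2 := by
    intro c hc
    refine sum_le_two_of_unique (fun t ht => (hK t ?_).2.1) fun t ht t' ht' hf hf' => ?_
    · exact Finset.mem_range.1 (Finset.mem_filter.1 (Finset.mem_filter.1 ht).1).1
    · obtain ⟨ht1, htc⟩ := Finset.mem_filter.1 ht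
      obtain ⟨ht1', htc'⟩ := Finset.mem_filter.1 ht'
      obtain ⟨htn, hne, -⟩ := Finset.mem_filter.1 ht1
      obtain ⟨htn', hne', -⟩ := Finset.mem_filter.1 ht1'
      rw [Finset.mem_range] at htn htn'
      have hx : t ∈ crossTimes ω n c := by
        rw [crossTimes_eq_filter hW c]; exact Finset.mem_filter.2 ⟨Finset.mem_range.2 htn, hne, htc⟩
      have hx' : t' ∈ crossTimes ω n c := by
        rw [crossTimes_eq_filter hW c]; exact Finset.mem_filter.2 ⟨Finset.mem_range.2 htn', hne', htc'⟩
      have h0 := ((hK t htn).2.2 hf).2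
      have h0' := ((hK t' htn').2.2 hf').2
      exact crossTimes_col_inj hW.inj hW.cols hx hx' (by rw [h0, h0'])
  calc ∑ c ∈ R, ∑ t ∈ ((Finset.range n).filter (fun t => ω t 1 ≠ ω (t + 1) 1 ∧ cutOf ω t ∈ R)).filter
          (fun t => cutOf ω t = c), K t
      ≤ ∑ _c ∈ R, 2 := Finset.sum_le_sum hinner
    _ = 2 * R.card := by rw [Finset.sum_const, smul_eq_mul, mul_comm]

/-- The column-`0` indicator of a site. [cite: BeatonBousquetMelouDeGierDuminilCopinGuttmann2014, §3.2 (arXiv v5 p. 11)] -/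
def indC0 (z : Site 2) : ℕ := if z 0 = 0 then 1 else 0

/-- `countP colZero` of a cons. [cite: BeatonBousquetMelouDeGierDuminilCopinGuttmann2014, §3.2 (arXiv v5 p. 11)] -/
theorem countP_colZero_cons (a : Site 2) (l : List (Site 2)) :
    (a :: l).countP colZero = l.countP colZero + indC0 a := by
  rw [List.countP_cons]; unfold indC0 colZero; simp only [decide_eq_true_eq]

/-- Positional sum of the bottom-row indicator along a list = its count (any default value).
[cite: BeatonBousquetMelouDeGierDuminilCopinGuttmann2014, §3.2 (arXiv v5 p. 11)] -/
theorem sum_indC0_getD (d : Site 2) : ∀ l : List (Site 2),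
    ∑ t ∈ Finset.range l.length, indC0 ((l[t]?).getD d) = l.countP colZero
  | [] => by simp
  | a :: l => by
    rw [List.length_cons, Finset.sum_range_succ', countP_colZero_cons, ← sum_indC0_getD d l]
    simp only [List.getElem?_cons_succ, List.getElem?_cons_zero, Option.getD_some]

/-- Reading a list as a vertex function: the bottom-row count is the list count. [cite: BeatonBousquetMelouDeGierDuminilCopinGuttmann2014, §3.2 (arXiv v5 p. 11)] -/
theorem visitsC0_ofList {l : List (Site 2)} (hl : l ≠ []) :
    visitsC0 (StripInsertion.ofList l) (l.length - 1) = l.countP colZero := by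
  have hlen : l.length - 1 + 1 = l.length := Nat.succ_pred_eq_of_pos (List.length_pos_of_ne_nil hl)
  unfold visitsC0
  rw [hlen, ← sum_indC0_getD (l.getLast?.getD 0) l]
  rfl

end SlabInsertion

/-! ### The column-zero count of the insertion `HexBW.slabInsertion` -/

section Insertion

open SlabInsertion

variable {T n : ℕ}

/-- `leftVisits` is the indicator sum `visitsC0` of the placed walk. [cite: BeatonBousquetMelouDeGierDuminilCopinGuttmann2014, §3.2 (arXiv v5 p. 11)] -/
theorem leftVisits_eq_visitsC0 (a : Site 2) (υ : ℕ → Site 2) (n : ℕ) :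
    leftVisits a υ n = visitsC0 (fun t => a + υ t) n := rfl

/-- **`i(ω) ≤ i(Ψ(ω,R)) ≤ i(ω) + 4·|R|` for the insertion of the door «HEX-STRIP-STRICT»**: the number of bottom-row
vertices of the image pair. [cite: MadrasSlade1993, §8.2, Theorem 8.2.1 (8.2.13), p. 269 (statement; the insertion is the lane's proof)]
[cite: BeatonBousquetMelouDeGierDuminilCopinGuttmann2014, Proposition 7 (arXiv v5 p. 11)] -/
theorem leftVisits_slabInsertion {H : ℕ} (n : ℕ) {p : Site 2 × (ℕ → Site 2)} (R : Finset ℤ) (hp : p ∈ slabPairs H n) :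
    leftVisits p.1 p.2 n ≤ leftVisits (slabInsertion H n p R).1 (slabInsertion H n p R).2
        (n + ∑ c ∈ R, slabInsertionCost H n p c) ∧
      leftVisits (slabInsertion H n p R).1 (slabInsertion H n p R).2 (n + ∑ c ∈ R, slabInsertionCost H n p c) ≤
        leftVisits p.1 p.2 n + 2 * R.card := by
  obtain ⟨hW, h0⟩ := slabWalk_of_mem hp
  set L := imageList H ((p.1 + p.2 0) 1) R (fun t => p.1 + p.2 t) n with hL
  have hLne : L ≠ [] := imageList_ne_nil _ _ _ _ _
  have hlen : n + ∑ c ∈ R, slabInsertionCost H n p c = L.length - 1 := by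
    rw [hL, length_imageList hW]; unfold slabInsertionCost; omega
  have himg : leftVisits (slabInsertion H n p R).1 (slabInsertion H n p R).2
      (n + ∑ c ∈ R, slabInsertionCost H n p c) = L.countP colZero := by
    rw [hlen, leftVisits_eq_visitsC0, ← visitsC0_ofList hLne]
    unfold visitsC0
    refine Finset.sum_congr rfl fun t _ => ?_
    have e : (slabInsertion H n p R).1 + (slabInsertion H n p R).2 t = StripInsertion.ofList L t := by
      simp only [slabInsertion, psi, h0]; rw [hL, h0]; abel
    show (if ((slabInsertion H n p R).1 + (slabInsertion H n p R).2 t) 0 = 0 then 1 else 0) = _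
    rw [e]
  have hsrc : leftVisits p.1 p.2 n = visitsC0 (fun t => p.1 + p.2 t) n := rfl
  have key := countP_colZero_imageList (y₀ := (p.1 + p.2 0) 1) (R := R) hW
  rw [himg, hsrc]
  exact key

/-! ### The weighted core -/

/-- `y^{i(Ψ)} ≥ y^{i(ω)} · θ^{|R|}` with `θ = min 1 (y^4)`. [cite: BeatonBousquetMelouDeGierDuminilCopinGuttmann2014, Proposition 7 (arXiv v5 p. 11)] -/
theorem pow_leftVisits_slabInsertion_ge {H : ℕ} (n : ℕ) {p : Site 2 × (ℕ → Site 2)} (R : Finset ℤ)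
    (hp : p ∈ slabPairs H n) {y : ℝ} (hy : 0 < y) :
    y ^ leftVisits p.1 p.2 n * (min 1 (y ^ 2)) ^ R.card ≤
      y ^ leftVisits (slabInsertion H n p R).1 (slabInsertion H n p R).2
        (n + ∑ c ∈ R, slabInsertionCost H n p c) := by
  obtain ⟨h1, h2⟩ := leftVisits_slabInsertion n R hp
  set V := leftVisits p.1 p.2 n
  set V' := leftVisits (slabInsertion H n p R).1 (slabInsertion H n p R).2
    (n + ∑ c ∈ R, slabInsertionCost H n p c)
  rcases le_or_gt 1 y with hy1 | hy1
  · have : min 1 (y ^ 2) = 1 := min_eq_left (one_le_pow₀ hy1)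
    rw [this, one_pow, mul_one]
    exact pow_le_pow_right₀ hy1 h1
  · have hy4 : y ^ 2 ≤ 1 := pow_le_one₀ hy.le hy1.le
    rw [min_eq_right hy4, ← pow_mul]
    calc y ^ V * y ^ (2 * R.card) = y ^ (V + 2 * R.card) := by rw [pow_add]
      _ ≤ y ^ V' := pow_le_pow_of_le_one hy.le hy1.le h2

/-- **The weighted finite core of «HEX-STRIP-STRICT-Y»**: for `y > 0`, `0 < x ≤ 1` and `θ = min 1 (y⁴)`,
`Ĉ_{H,n}(y) xⁿ (1 + θ x^{2H+4})^{⌊n/(2(H+1))⌋} ≤ Σ_{m ≤ (2H+5)n} Ĉ_{H+1,m}(y) x^m`, `θ = min 1 (y²)` (sum over (walk, admissible cut set)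
of `x^{length} y^{i}` of the image, bounded below walk by walk and above by injectivity).
[cite: BeatonBousquetMelouDeGierDuminilCopinGuttmann2014, Proposition 7 (arXiv v5 p. 11: μ_T(1,y) < μ_{T+1}(1,y); the insertion and the finite inequality are the lane's)] -/
theorem slab_weighted_core (H n : ℕ) {x y : ℝ} (hx : 0 < x) (hx1 : x ≤ 1) (hy : 0 < y) :
    slabZ H n y * x ^ n * (1 + min 1 (y ^ 2) * x ^ (2 * H + 4)) ^ (n / (2 * (H + 1))) ≤
      ∑ m ∈ Finset.range ((2 * H + 5) * n + 1), slabZ (H + 1) m y * x ^ m := by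
  classical
  have hcost : ∀ n p, p ∈ slabPairs H n → ∀ c ∈ admissibleSlabCuts H p.1 p.2 n, slabInsertionCost H n p c ≤ 2 * H + 4 :=
    fun n p hp c hc => slabInsertionCost_le n p hp c hc
  have hmem : ∀ n p R, p ∈ slabPairs H n → R ⊆ admissibleSlabCuts H p.1 p.2 n →
      slabInsertion H n p R ∈ slabPairs (H + 1) (n + ∑ c ∈ R, slabInsertionCost H n p c) :=
    fun n p R hp hR => slabInsertion_mem n p R hp hR
  have hinj := fun n => slabInsertion_injOn_insDom H n
  set θ := min 1 (y ^ 2) with hθ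
  have hθ0 : 0 ≤ θ := le_min zero_le_one (pow_nonneg hy.le 2)
  have hθ1 : θ ≤ 1 := min_le_left _ _
  -- the weighted sum over the domain
  set F : (Σ _ : Site 2 × (ℕ → Site 2), Finset ℤ) → ℝ := fun q =>
    x ^ slabInsLen (slabInsertionCost H) n q *
      y ^ leftVisits (slabInsertion H n q.1 q.2).1 (slabInsertion H n q.1 q.2).2 (slabInsLen (slabInsertionCost H) n q)
    with hF
  -- lower bound, walk by walk
  have hlow : slabZ H n y * x ^ n * (1 + θ * x ^ (2 * H + 4)) ^ (n / (2 * (H + 1))) ≤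
      ∑ q ∈ slabInsDom H n, F q := by
    rw [slabInsDom, Finset.sum_sigma, slabZ, Finset.sum_mul, Finset.sum_mul]
    refine Finset.sum_le_sum fun p hp => ?_
    have hp' : (p.1, p.2) ∈ slabPairs H n := hp
    -- `Σ_{R ⊆ adm} F(p,R) ≥ y^V xⁿ Σ_R Π_{c∈R} θ x^{cost c} = y^V xⁿ Π_{c∈adm} (1 + θ x^{cost c})`
    have hstep : y ^ leftVisits p.1 p.2 n * x ^ n *
        ∏ c ∈ admissibleSlabCuts H p.1 p.2 n, (1 + θ * x ^ slabInsertionCost H n p c) ≤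
        ∑ R ∈ (admissibleSlabCuts H p.1 p.2 n).powerset, F ⟨p, R⟩ := by
      rw [Finset.prod_one_add, Finset.mul_sum]
      refine Finset.sum_le_sum fun R hR => ?_
      have hRsub := Finset.mem_powerset.1 hR
      have hpow := pow_leftVisits_slabInsertion_ge n R hp hy
      show y ^ leftVisits p.1 p.2 n * x ^ n * ∏ c ∈ R, (θ * x ^ slabInsertionCost H n p c) ≤
        x ^ (n + ∑ c ∈ R, slabInsertionCost H n p c) *
          y ^ leftVisits (slabInsertion H n p R).1 (slabInsertion H n p R).2
            (n + ∑ c ∈ R, slabInsertionCost H n p c)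
      rw [Finset.prod_mul_distrib, Finset.prod_const, Finset.prod_pow_eq_pow_sum, pow_add]
      calc y ^ leftVisits p.1 p.2 n * x ^ n * (θ ^ R.card * x ^ ∑ c ∈ R, slabInsertionCost H n p c)
          = x ^ n * x ^ (∑ c ∈ R, slabInsertionCost H n p c) * (y ^ leftVisits p.1 p.2 n * θ ^ R.card) := by
            ring
        _ ≤ x ^ n * x ^ (∑ c ∈ R, slabInsertionCost H n p c) *
            y ^ leftVisits (slabInsertion H n p R).1 (slabInsertion H n p R).2
              (n + ∑ c ∈ R, slabInsertionCost H n p c) :=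
            mul_le_mul_of_nonneg_left hpow (by positivity)
    refine le_trans ?_ hstep
    refine mul_le_mul_of_nonneg_left ?_ (by positivity)
    calc (1 + θ * x ^ (2 * H + 4)) ^ (n / (2 * (H + 1)))
        ≤ (1 + θ * x ^ (2 * H + 4)) ^ (admissibleSlabCuts H p.1 p.2 n).card :=
          pow_le_pow_right₀ (by nlinarith [pow_nonneg hx.le (2 * H + 4)]) (div_le_card_admissibleSlabCuts hp')
      _ = ∏ _c ∈ admissibleSlabCuts H p.1 p.2 n, (1 + θ * x ^ (2 * H + 4)) := (Finset.prod_const _).symm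
      _ ≤ ∏ c ∈ admissibleSlabCuts H p.1 p.2 n, (1 + θ * x ^ slabInsertionCost H n p c) :=
          Finset.prod_le_prod (fun c _ => by nlinarith [pow_nonneg hx.le (2 * H + 4)]) fun c hc => by
            have := pow_le_pow_of_le_one hx.le hx1 (hcost n p hp c hc)
            nlinarith
  -- upper bound, by injectivity, fiberwise in the image length
  have hup : ∑ q ∈ slabInsDom H n, F q ≤ ∑ m ∈ Finset.range ((2 * H + 5) * n + 1), slabZ (H + 1) m y * x ^ m := by
    rw [← Finset.sum_fiberwise_of_maps_to (g := slabInsLen (slabInsertionCost H) n)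
      (t := Finset.range ((2 * H + 5) * n + 1)) fun q hq => Finset.mem_range.2 (Nat.lt_succ_of_le (slabInsLen_le (hcost n) hq))]
    refine Finset.sum_le_sum fun m _ => ?_
    -- in the fiber `slabInsLen = m`: `Σ F = x^m Σ y^{i(Ψ q)} ≤ x^m C_{T+1,m}(y)`
    have e1 : ∑ q ∈ (slabInsDom H n).filter (fun q => slabInsLen (slabInsertionCost H) n q = m), F q =
        x ^ m * ∑ q ∈ (slabInsDom H n).filter (fun q => slabInsLen (slabInsertionCost H) n q = m),
          y ^ leftVisits (slabInsertion H n q.1 q.2).1 (slabInsertion H n q.1 q.2).2 m := by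
      rw [Finset.mul_sum]
      refine Finset.sum_congr rfl fun q hq => ?_
      rw [hF]; simp only
      rw [(Finset.mem_filter.1 hq).2]
    rw [e1, mul_comm]
    refine mul_le_mul_of_nonneg_right ?_ (pow_nonneg hx.le m)
    rw [slabZ, ← Finset.sum_image (f := fun p' : Site 2 × (ℕ → Site 2) => y ^ leftVisits p'.1 p'.2 m)
      (g := fun q : (Σ _ : Site 2 × (ℕ → Site 2), Finset ℤ) => slabInsertion H n q.1 q.2)
      (hinj n |>.mono fun q hq => by
        have h := Finset.mem_filter.1 (Finset.mem_coe.1 hq)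
        exact Finset.mem_coe.2 h.1)]
    refine Finset.sum_le_sum_of_subset_of_nonneg (fun p' hp' => ?_) fun _ _ _ => pow_nonneg hy.le _
    obtain ⟨q, hq, rfl⟩ := Finset.mem_image.1 hp'
    obtain ⟨hq1, hqm⟩ := Finset.mem_filter.1 hq
    obtain ⟨hqp, hqR⟩ := mem_slabInsDom.1 hq1
    have := hmem n q.1 q.2 hqp hqR
    rw [show n + ∑ c ∈ q.2, slabInsertionCost H n q.1 c = m from hqm] at this
    exact this
  exact hlow.trans hup

end Insertion

end Literature.Probability.RandomPlanarGeometry.SAW.HexBW
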